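import Summits.Ventures.PercRepro0.RightCont

/-!
# L4 · NONTRIVIAL, lower bound, kernel-checked against `Defs.lean` (seat p5): `θ_d(p) = 0` for `p < 1/(2d)`

Cell pub-perc-repro0, seat p2.  The path-counting union bound of GLUE-p2-v2 L4(i) in its simpler
`1/(2d)` form (SHARP-S3's constant): an open path from `0` to `∂Λ_n` contains a self-avoiding open
path of exactly `n` steps from `0`; such a path is encoded by its sequence of `n` unit steps
(`(2d)^n` sequences); a fixed self-avoiding sequence has its `n` distinct bonds open with probability
`p^n`.  Hence `P_p(0 ↔ ∂Λ_n) ≤ (2d p)^n → 0` when `2d p < 1`, so `θ_d(p) = 0` and `p_c(d) ≥ 1/(2d)`.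

* `measure_reach_le`      : `P_p(0 ↔ ∂Λ_n) ≤ (2d)^n p^n`;
* `thetaI_eq_zero_of_lt`  : `p < 1/(2d) ⇒ θ_d(p) = 0`;
* `inv_two_d_le_pc`       : `d ≥ 1 ⇒ 1/(2d) ≤ p_c(d)` (given that `{p : θ_d(p) > 0}` is nonempty, i.e.
  `θ_d(1) = 1`; discharged in `AllOpen.lean`).
The route's constant `1/(2d−1)` is obtained in `NonBacktrack.lean`.
-/

open MeasureTheory ProbabilityTheory unitInterval
open scoped ENNReal Topology

namespace Summit.Ventures.PercRepro0.L2

open Summit.Ventures.PercRepro0.Defs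

variable {d : ℕ}

-- BEGIN BODY

/-! ### Unit steps and direction sequences -/

/-- The unit step from `x` in direction `i` with sign `b` (`true` = `+e_i`, `false` = `−e_i`). -/
def step (x : Vertex d) (i : Fin d) (b : Bool) : Vertex d :=
  Function.update x i (x i + if b then 1 else -1)

/-- A unit step is a lattice bond. -/
lemma lattice_adj_step (x : Vertex d) (i : Fin d) (b : Bool) : (lattice d).Adj x (step x i b) := by
  show (∑ j, |x j - step x i b j|) = 1
  rw [Finset.sum_eq_single i]
  · simp only [step, Function.update_self]
    cases b <;> simp
  · intro j _ hj
    simp [step, Function.update_of_ne hj]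
  · intro h; exact absurd (Finset.mem_univ i) h

/-- Every lattice bond from `x` is a unit step. -/
lemma exists_step_of_adj {x y : Vertex d} (h : (lattice d).Adj x y) : ∃ i b, step x i b = y := by
  have hsum : (∑ j, |x j - y j|) = 1 := h
  have hnn : ∀ j ∈ (Finset.univ : Finset (Fin d)), 0 ≤ |x j - y j| := fun j _ => abs_nonneg _
  obtain ⟨i, -, hi⟩ : ∃ i ∈ (Finset.univ : Finset (Fin d)), |x i - y i| ≠ 0 :=
    Finset.exists_ne_zero_of_sum_ne_zero (by rw [hsum]; exact one_ne_zero)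
  have hi1 : 1 ≤ |x i - y i| := by
    have := abs_nonneg (x i - y i)
    omega
  have hrest : (∑ j ∈ Finset.univ.erase i, |x j - y j|) = 0 := by
    have := Finset.add_sum_erase Finset.univ (fun j => |x j - y j|) (Finset.mem_univ i)
    rw [hsum] at this
    have hnn' : 0 ≤ ∑ j ∈ Finset.univ.erase i, |x j - y j| :=
      Finset.sum_nonneg fun j _ => abs_nonneg _
    omega
  have hzero : ∀ j ≠ i, |x j - y j| = 0 := by
    intro j hj
    have := (Finset.sum_eq_zero_iff_of_nonneg fun j _ => abs_nonneg (x j - y j)).1 hrest j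
      (Finset.mem_erase.2 ⟨hj, Finset.mem_univ j⟩)
    exact this
  have hi_eq : |x i - y i| = 1 := by
    have := Finset.add_sum_erase Finset.univ (fun j => |x j - y j|) (Finset.mem_univ i)
    rw [hsum, hrest] at this
    omega
  rcases abs_eq (zero_le_one : (0 : ℤ) ≤ 1) |>.1 hi_eq with hpos | hneg
  · refine ⟨i, false, ?_⟩
    funext j
    by_cases hj : j = i
    · subst hj; simp [step]; omega
    · simp only [step, Function.update_of_ne hj]
      have := hzero j hj
      rw [abs_eq_zero] at this
      omega
  · refine ⟨i, true, ?_⟩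
    funext j
    by_cases hj : j = i
    · subst hj; simp [step]; omega
    · simp only [step, Function.update_of_ne hj]
      have := hzero j hj
      rw [abs_eq_zero] at this
      omega

/-- The direction of a lattice bond `x ~ y` (chosen). -/
noncomputable def dirOf {x y : Vertex d} (h : (lattice d).Adj x y) : Fin d × Bool :=
  ⟨Classical.choose (exists_step_of_adj h),
    Classical.choose (Classical.choose_spec (exists_step_of_adj h))⟩

/-- `dirOf` recovers the bond. -/
lemma step_dirOf {x y : Vertex d} (h : (lattice d).Adj x y) :
    step x (dirOf h).1 (dirOf h).2 = y :=
  Classical.choose_spec (Classical.choose_spec (exists_step_of_adj h))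

/-- The vertices visited by a sequence of `n` unit steps from the origin (constant after `n`). -/
def vtx {n : ℕ} (s : Fin n → Fin d × Bool) : ℕ → Vertex d
  | 0 => 0
  | k + 1 => if h : k < n then step (vtx s k) (s ⟨k, h⟩).1 (s ⟨k, h⟩).2 else vtx s k

/-- The `k`-th bond of a direction sequence. -/
def bondOf {n : ℕ} (s : Fin n → Fin d × Bool) (k : Fin n) : Sym2 (Vertex d) :=
  s(vtx s k, vtx s (k + 1))

/-- Step `k` of a direction sequence. -/
lemma vtx_succ {n : ℕ} (s : Fin n → Fin d × Bool) (k : Fin n) :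
    vtx s (k + 1) = step (vtx s k) (s k).1 (s k).2 := by
  simp [vtx, k.2]

/-- The bonds of a direction sequence are lattice bonds. -/
lemma bondOf_mem_bonds {n : ℕ} (s : Fin n → Fin d × Bool) (k : Fin n) : bondOf s k ∈ bonds d := by
  rw [bondOf, vtx_succ]
  exact (SimpleGraph.mem_edgeSet (lattice d)).2 (lattice_adj_step _ _ _)

/-! ### Extracting a direction sequence from an open path -/

/-- The open graph is a subgraph of the lattice. -/
lemma openGraph_le_lattice (ω : Config d) : openGraph d ω ≤ lattice d := by
  intro x y h
  exact ((openGraph_adj_iff ω x y).1 h).1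

/-- Along a walk in the open graph the sup-norm grows by at most the length. -/
lemma nrm_le_length {ω : Config d} {x y : Vertex d} (w : (openGraph d ω).Walk x y) :
    nrm y ≤ nrm x + w.length := by
  induction w with
  | nil => simp
  | cons hadj _ ih =>
    have := nrm_le_of_adj ((openGraph_adj_iff _ _ _).1 hadj).1
    simp only [SimpleGraph.Walk.length_cons]
    omega

/-- The direction sequence of the first `n` steps of a walk of length `≥ n` in the open graph. -/
noncomputable def dirSeq {ω : Config d} {y : Vertex d} (w : (openGraph d ω).Walk 0 y) (n : ℕ)
    (hn : n ≤ w.length) : Fin n → Fin d × Bool :=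
  fun k => dirOf ((openGraph_adj_iff ω _ _).1 (w.adj_getVert_succ (by omega : (k : ℕ) < w.length))).1

/-- The vertices of the direction sequence of `w` are the vertices of `w`. -/
lemma vtx_dirSeq {ω : Config d} {y : Vertex d} (w : (openGraph d ω).Walk 0 y) (n : ℕ)
    (hn : n ≤ w.length) : ∀ k ≤ n, vtx (dirSeq w n hn) k = w.getVert k := by
  intro k
  induction k with
  | zero => intro _; simp [vtx]
  | succ k ih =>
    intro hk
    have hk' : k < n := by omega
    rw [vtx_succ (dirSeq w n hn) ⟨k, hk'⟩, ih (by omega)]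
    exact step_dirOf _

/-- The bonds of the direction sequence of `w` are open. -/
lemma bondOf_dirSeq_mem {ω : Config d} {y : Vertex d} (w : (openGraph d ω).Walk 0 y) (n : ℕ)
    (hn : n ≤ w.length) (k : Fin n) : bondOf (dirSeq w n hn) k ∈ ω := by
  rw [bondOf, vtx_dirSeq w n hn k (by omega), vtx_dirSeq w n hn (k + 1) (by omega)]
  exact ((openGraph_adj_iff ω _ _).1 (w.adj_getVert_succ (by omega : (k : ℕ) < w.length))).2

/-- For a self-avoiding `w`, the bonds of its direction sequence are pairwise distinct. -/
lemma bondOf_dirSeq_injective {ω : Config d} {y : Vertex d} (w : (openGraph d ω).Walk 0 y)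
    (hw : w.IsPath) (n : ℕ) (hn : n ≤ w.length) : Function.Injective (bondOf (dirSeq w n hn)) := by
  intro k l hkl
  have hinj := hw.getVert_injOn
  simp only [bondOf, vtx_dirSeq w n hn k (by omega), vtx_dirSeq w n hn (k + 1) (by omega),
    vtx_dirSeq w n hn l (by omega), vtx_dirSeq w n hn (l + 1) (by omega), Sym2.eq_iff] at hkl
  rcases hkl with ⟨h1, -⟩ | ⟨h1, h2⟩
  · exact Fin.ext (hinj (by simp; omega) (by simp; omega) h1)
  · have e1 : (k : ℕ) = l + 1 := hinj (by simp; omega) (by simp; omega) h1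
    have e2 : (k : ℕ) + 1 = l := hinj (by simp; omega) (by simp; omega) h2
    omega

/-! ### The union bound -/

/-- The event "all bonds of the direction sequence `s` are open". -/
def seqEvent {n : ℕ} (s : Fin n → Fin d × Bool) : Set (Config d) := {ω | ∀ k, bondOf s k ∈ ω}

/-- The self-avoiding direction sequences of length `n`. -/
noncomputable def saSeqs (d n : ℕ) : Finset (Fin n → Fin d × Bool) := by
  classical exact Finset.univ.filter fun s => Function.Injective (bondOf s)

/-- `{0 ↔ ∂Λ_n}` is covered by the events of the self-avoiding sequences of length `n`. -/
lemma reach_subset_biUnion (n : ℕ) : reach d n ⊆ ⋃ s ∈ saSeqs d n, seqEvent s := by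
  classical
  rintro ω ⟨y, hy, hc⟩
  obtain ⟨w0⟩ := conn_of_connIn hc
  have hw : w0.bypass.IsPath := w0.bypass_isPath
  have hlen : n ≤ w0.bypass.length := by
    have := nrm_le_length w0.bypass
    simp only [nrm_zero, zero_add] at this
    omega
  simp only [Set.mem_iUnion, exists_prop, saSeqs, Finset.mem_filter, Finset.mem_univ, true_and]
  exact ⟨dirSeq w0.bypass n hlen, bondOf_dirSeq_injective w0.bypass hw n hlen,
    fun k => bondOf_dirSeq_mem w0.bypass n hlen k⟩

/-- A self-avoiding sequence has its `n` bonds open with probability `p^n`. -/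
lemma measure_seqEvent {n : ℕ} {s : Fin n → Fin d × Bool} (hs : Function.Injective (bondOf s))
    (p : I) : P d p (seqEvent s) = (toNNReal p : ℝ≥0∞) ^ n := by
  classical
  have hE : seqEvent s = cylS (Finset.univ.image (bondOf s)) fun _ => true := by
    ext ω
    simp only [seqEvent, Set.mem_setOf_eq, mem_cylS, iff_true]
    constructor
    · rintro h ⟨e, he⟩
      obtain ⟨k, -, rfl⟩ := Finset.mem_image.1 he
      exact h k
    · intro h k
      exact h ⟨bondOf s k, Finset.mem_image_of_mem _ (Finset.mem_univ k)⟩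
  rw [hE, measure_cylS _ (fun e he => by
    obtain ⟨k, -, rfl⟩ := Finset.mem_image.1 he
    exact bondOf_mem_bonds s k)]
  simp only [if_true, Finset.prod_const, Finset.card_univ, Fintype.card_coe]
  rw [Finset.card_image_of_injective _ hs, Finset.card_univ, Fintype.card_fin]

/-- The union bound: `P_p(0 ↔ ∂Λ_n) ≤ (2d)^n p^n`. -/
lemma measure_reach_le (n : ℕ) (p : I) :
    P d p (reach d n) ≤ ((2 * d : ℕ) : ℝ≥0∞) ^ n * (toNNReal p : ℝ≥0∞) ^ n := by
  classical
  calc P d p (reach d n)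
      ≤ P d p (⋃ s ∈ saSeqs d n, seqEvent s) := measure_mono (reach_subset_biUnion n)
    _ ≤ ∑ s ∈ saSeqs d n, P d p (seqEvent s) := measure_biUnion_finset_le _ _
    _ = ∑ s ∈ saSeqs d n, (toNNReal p : ℝ≥0∞) ^ n := by
        refine Finset.sum_congr rfl fun s hs => ?_
        simp only [saSeqs, Finset.mem_filter] at hs
        exact measure_seqEvent hs.2 p
    _ = ((saSeqs d n).card : ℝ≥0∞) * (toNNReal p : ℝ≥0∞) ^ n := by
        rw [Finset.sum_const, nsmul_eq_mul]
    _ ≤ ((2 * d : ℕ) : ℝ≥0∞) ^ n * (toNNReal p : ℝ≥0∞) ^ n := by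
        gcongr
        have h1 : (saSeqs d n).card ≤ Fintype.card (Fin n → Fin d × Bool) :=
          (Finset.card_le_univ _)
        have h2 : Fintype.card (Fin n → Fin d × Bool) = (2 * d) ^ n := by
          rw [Fintype.card_fun, Fintype.card_prod, Fintype.card_fin, Fintype.card_bool,
            Fintype.card_fin]
          ring_nf
        rw [h2] at h1
        exact_mod_cast h1

/-- Real form: `P_p(0 ↔ ∂Λ_n) ≤ (2d p)^n` for `n ≥ 1`. -/
lemma toReal_toBoundary_le {n : ℕ} (hn : 1 ≤ n) (p : I) :
    (P d p (toBoundary d n)).toReal ≤ (2 * d * (p : ℝ)) ^ n := by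
  rw [toBoundary_eq_reach hn]
  have h := measure_reach_le (d := d) n p
  have h' := ENNReal.toReal_mono (by finiteness) h
  refine h'.trans (le_of_eq ?_)
  rw [ENNReal.toReal_mul, ENNReal.toReal_pow, ENNReal.toReal_pow, ENNReal.toReal_natCast,
    ENNReal.coe_toReal, unitInterval.coe_toNNReal, mul_pow]
  push_cast
  ring

/-- `θ_d(p) = 0` for `p < 1/(2d)`. -/
theorem thetaI_eq_zero_of_lt (p : I) (hp : 2 * (d : ℝ) * p < 1) : thetaI d p = 0 := by
  have hr : (0 : ℝ) ≤ 2 * d * p := mul_nonneg (by positivity) p.2.1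
  have hlim : Filter.Tendsto (fun n : ℕ => (2 * (d : ℝ) * p) ^ (n + 1)) Filter.atTop (𝓝 0) :=
    (tendsto_pow_atTop_nhds_zero_of_lt_one hr hp).comp (Filter.tendsto_add_atTop_nat 1)
  refine le_antisymm ?_ (thetaI_nonneg d p)
  refine le_of_tendsto_of_tendsto' tendsto_const_nhds hlim fun n => ?_
  exact (thetaI_le_toBoundary p (n := n + 1) (by omega)).trans (toReal_toBoundary_le (by omega) p)

/-- L4 (lower bound): `1/(2d) ≤ p_c(d)` for `d ≥ 1`, given that `{p ∈ [0,1] : θ_d(p) > 0}` is nonempty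
(which holds since `θ_d(1) = 1`, p5's `thetaI_one`). -/
theorem inv_two_d_le_pc (hd : 1 ≤ d) (hne : (pcSet d).Nonempty) : 1 / (2 * (d : ℝ)) ≤ pc d := by
  refine le_csInf hne fun q hq => ?_
  obtain ⟨⟨hq0, hq1⟩, hqpos⟩ := hq
  by_contra hlt
  push Not at hlt
  have hd' : (0 : ℝ) < 2 * d := by
    have : (1 : ℝ) ≤ d := by exact_mod_cast hd
    linarith
  have hq' : 2 * (d : ℝ) * q < 1 := by
    have := (lt_div_iff₀ hd').1 hlt
    linarith [this, mul_comm q (2 * (d : ℝ))]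
  have : theta d q = 0 := by
    unfold theta
    have hclamp : ((clamp q : I) : ℝ) = q := by
      simp [clamp, Set.coe_projIcc, hq0, hq1]
    exact thetaI_eq_zero_of_lt (clamp q) (by rw [hclamp]; exact hq')
  rw [this] at hqpos
  exact lt_irrefl _ hqpos

-- END BODY

end Summit.Ventures.PercRepro0.L2
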